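import Mathlib
import Summits.MatrixMultiplication.MatrixMultiplication.Theorems.SubgroupIdentityDesigns.Negative.CellTwoOneStatus
import Summits.MatrixMultiplication.MatrixMultiplication.Theorems.SubgroupIdentityDesigns.Negative.ProjectiveReduction
import Summits.MatrixMultiplication.MatrixMultiplication.Theorems.SubgroupIdentityDesigns.Negative.LineTransitiveMember
import Summits.MatrixMultiplication.MatrixMultiplication.Theorems.SubgroupIdentityDesigns.Negative.SingerLineTransitive

/-!
# The `(2,1)` cell is empty modulo Dickson — all `p ≥ 47`, all `0 < ε ≤ 1`

Route `LevelGradedCohnUmans`, crux `SubgroupIdentityDesigns` (stmt-MatrixMultiplication-14079), the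
`(m,k) = (2,1)` cell of the level-graded Cohn–Umans inequality.  VALUE = THEOREM / DECIDABLE VERDICT
on one cell, NOT summit progress: the crux quantifies over all `(p, m, k)` and stays open; this file
only shows that the smallest cell `GL₂(𝔽_p)`, level `k = 1`, contributes no witness (for `p ≥ 47`,
conditionally on Dickson's classification `DicksonList`, which is not in Mathlib).

`CandidatePrimes.lean` / `CellTwoOneStatus.lean` left exactly one residual family ("family I"):
`p ≡ 1 (mod 4)`, `ω(p-1) ≥ 3`, `ε > 772/775`, the three members conjugate into Singer normalisers
`N(C_n)` with `|Hᵢ| = |Sᵢ|(p+1)`, scalar parts `Sᵢ = Hᵢ ∩ Z` pairwise coprime of orders `≥ 2` with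
`|S₁||S₂||S₃| = p - 1` (so `S₁S₂S₃ = Z`).  This file kills family I for every `p` by one uniform
mechanism, with no computation:

* `no_levelOne_witness_of_conj_singerNormal` (UNCONDITIONAL, `p ≥ 7`, `0 < ε ≤ 1`): no subgroup-TPP
  triple whose three members are each conjugate into a Singer normaliser `N(C_n)` carries a level-one
  identity design satisfying the level-one crux inequality.  Proof: the scalar parts cover `Z`
  (`scalar_cover`), so applying the cover to the non-square `n·1` shows that some member `E = Hᵢ` has a
  NON-SQUARE central element; that member is transitive on the lines of `𝔽_p²`
  (`lineTransitive_of_conj_singerNormal`); any other member has a non-scalar element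
  (`|H_j| = |S_j|(p+1) > |S_j|`); and a line-transitive member plus a non-scalar element elsewhere
  contradicts the design (`no_levelOne_design_of_lineTransitive₁₂/₂₃/₃₂`, the projective
  line-certificate engine of `LineCertificate.lean`).
* `no_levelOne_witness_of_dicksonList_all` (`p ≥ 47`, `0 < ε ≤ 1`, modulo `DicksonList p n`): the
  `(2,1)` cell is EMPTY.  (`witness_status_of_dicksonList_of_fortyseven_le` forces `p ≥ 61`, then
  `witness_conj_singerNormal_of_dicksonList` puts the members into Singer normalisers.)

What remains DATA (not theorems): `p ≤ 43` (censuses, route folder `ORACLE-g1…g16`), and Dickson's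
list itself.
-/

set_option linter.dupNamespace false

noncomputable section

open scoped BigOperators Classical

open Summit.MatrixMultiplication.MatrixMultiplication.Theorems.LieRankDesigns.Negative (GLm Mat budget)

namespace Summit.MatrixMultiplication.MatrixMultiplication.Theorems.SubgroupIdentityDesigns.Negative

section CellTwoOneClosed

open Literature.Barriers.MatrixMultiplication (SubgroupTPP)

variable {p : ℕ} [hp : Fact p.Prime]

/-- A member of full projective size `|H| = |H ∩ Z|(p+1)` has a non-scalar element. -/
theorem exists_not_mem_range_scalarHom_of_card {H : Subgroup (GLm p 2)}
    (hH : Nat.card H = Nat.card (H.comap (scalarHom p 2)) * (p + 1)) :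
    ∃ h ∈ H, h ∉ (scalarHom p 2).range := by
  by_contra hall
  push Not at hall
  have hle : H ≤ (scalarHom p 2).range := fun h hh => hall h hh
  have hc : Nat.card H = Nat.card (H.comap (scalarHom p 2)) := by
    conv_lhs => rw [← Subgroup.map_comap_eq_self hle]
    exact Subgroup.card_map_of_injective scalarHom_injective
  rw [hc] at hH
  have hpos : 0 < Nat.card (H.comap (scalarHom p 2)) := Nat.card_pos
  have hp1 : 1 ≤ p := hp.out.one_le
  nlinarith

/-- **NO LEVEL-ONE WITNESS ON THREE SINGER-NORMALISER MEMBERS** (unconditional; `p ≥ 7`,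
`0 < ε ≤ 1`).  If `(H₁, H₂, H₃)` is subgroup-TPP in `GL₂(𝔽_p)`, carries a level-`1` identity design,
and each `Hᵢ` is conjugate into the normaliser of a non-split torus `C_n` (`n` a non-square), then
the level-one crux inequality `budget p 2 1 (2+ε) < (|H₁||H₂||H₃|)^{(2+ε)/3}` fails. -/
theorem no_levelOne_witness_of_conj_singerNormal (hp7 : 7 ≤ p) {n : ZMod p}
    (hn : ∀ x : ZMod p, x * x ≠ n) {ε : ℝ} (hε : 0 < ε) (hε1 : ε ≤ 1)
    {H₁ H₂ H₃ : Subgroup (GLm p 2)} (htpp : SubgroupTPP H₁ H₂ H₃)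
    (hdesign : ∃ c : Mat p 2 → ℂ, (∀ M, 1 < M.rank → c M = 0) ∧
      (∑ M, c M * ZMod.stdAddChar (Matrix.trace (M * ((1 : GLm p 2) : Mat p 2)))) = 1 ∧
      ∀ a ∈ H₁, ∀ b ∈ H₂, ∀ g ∈ H₃, a * b * g ≠ 1 →
        (∑ M, c M *
          ZMod.stdAddChar (Matrix.trace (M * ((a * b * g : GLm p 2) : Mat p 2)))) = 0)
    (h₁ : ∃ g : GLm p 2, ∀ x ∈ H₁, IsSingerNormal n (g * x * g⁻¹))
    (h₂ : ∃ g : GLm p 2, ∀ x ∈ H₂, IsSingerNormal n (g * x * g⁻¹))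
    (h₃ : ∃ g : GLm p 2, ∀ x ∈ H₃, IsSingerNormal n (g * x * g⁻¹)) :
    ¬ budget p 2 1 (2 + ε) <
      ((Nat.card H₁ * Nat.card H₂ * Nat.card H₃ : ℕ) : ℝ) ^ ((2 + ε) / 3) := by
  intro hwit
  have hp3 : 3 ≤ p := by omega
  have hp2 : p ≠ 2 := by omega
  obtain ⟨hf₁, hf₂, hf₃⟩ := levelOne_witness_free_vector hp3 hε hε1 htpp hdesign hwit
  obtain ⟨g₁, hg₁⟩ := h₁
  obtain ⟨g₂, hg₂⟩ := h₂
  obtain ⟨g₃, hg₃⟩ := h₃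
  have x₁ := image_le_of_conj_singerNormal hp3 hn hg₁ hf₁
  have x₂ := image_le_of_conj_singerNormal hp3 hn hg₂ hf₂
  have x₃ := image_le_of_conj_singerNormal hp3 hn hg₃ hf₃
  obtain ⟨c₁, c₂, c₃, -, -, -, -, -, -, hprod⟩ :=
    witness_scalars_of_images_le hp7 hε hε1 htpp hdesign hwit x₁ x₂ x₃
  -- the scalar parts cover the centre
  have hZ := scalar_cover htpp hprod
  -- the non-square scalar `n·1` is a product of member scalars, one of which is a non-square
  have hn0 : n ≠ 0 := fun h0 => hn 0 (by rw [h0, mul_zero])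
  obtain ⟨s₁, hs₁, s₂, hs₂, s₃, hs₃, hsprod⟩ := hZ (scalarHom p 2 (Units.mk0 n hn0)) ⟨_, rfl⟩
  obtain ⟨hs₁H, u₁, rfl⟩ := Subgroup.mem_inf.mp hs₁
  obtain ⟨hs₂H, u₂, rfl⟩ := Subgroup.mem_inf.mp hs₂
  obtain ⟨hs₃H, u₃, rfl⟩ := Subgroup.mem_inf.mp hs₃
  have hu : u₁ * u₂ * u₃ = Units.mk0 n hn0 :=
    scalarHom_injective (by rw [map_mul, map_mul, hsprod])
  have hnsq : ¬ IsSquare (Units.mk0 n hn0) := by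
    rintro ⟨r, hr⟩
    have e := congrArg Units.val hr
    rw [Units.val_mk0, Units.val_mul] at e
    exact hn (r : ZMod p) e.symm
  have hcase : ¬ IsSquare u₁ ∨ ¬ IsSquare u₂ ∨ ¬ IsSquare u₃ := by
    by_contra h
    push Not at h
    obtain ⟨q₁, q₂, q₃⟩ := h
    exact hnsq (hu ▸ (q₁.mul q₂).mul q₃)
  rcases hcase with hq | hq | hq
  · -- `H₁` is line-transitive, `H₂` has a non-scalar element
    have htrans := lineTransitive_of_conj_singerNormal hp2 hn hg₁ c₁ hf₁
      ⟨u₁, Subgroup.mem_comap.mpr hs₁H, hq⟩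
    obtain ⟨h, hh, hhZ⟩ := exists_not_mem_range_scalarHom_of_card c₂
    exact no_levelOne_design_of_lineTransitive₁₂ htpp hZ htrans hh hhZ hdesign
  · -- `H₂` is line-transitive, `H₃` has a non-scalar element
    have htrans := lineTransitive_of_conj_singerNormal hp2 hn hg₂ c₂ hf₂
      ⟨u₂, Subgroup.mem_comap.mpr hs₂H, hq⟩
    obtain ⟨h, hh, hhZ⟩ := exists_not_mem_range_scalarHom_of_card c₃
    exact no_levelOne_design_of_lineTransitive₂₃ htpp hZ htrans hh hhZ hdesign
  · -- `H₃` is line-transitive, `H₂` has a non-scalar element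
    have htrans := lineTransitive_of_conj_singerNormal hp2 hn hg₃ c₃ hf₃
      ⟨u₃, Subgroup.mem_comap.mpr hs₃H, hq⟩
    obtain ⟨h, hh, hhZ⟩ := exists_not_mem_range_scalarHom_of_card c₂
    exact no_levelOne_design_of_lineTransitive₃₂ htpp hZ htrans hh hhZ hdesign

/-- **THE `(2,1)` CELL IS EMPTY MODULO DICKSON** (`p ≥ 47`, all `0 < ε ≤ 1`).  Under Dickson's list
`DicksonList p n` for the subgroups of `GL₂(𝔽_p)` of order prime to `p`, no subgroup-TPP triple in
`GL₂(𝔽_p)` carrying a level-one identity design satisfies the level-one crux inequality.  This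
supersedes `no_levelOne_witness_of_dicksonList` (`ε ≤ 0.98`) and `CandidatePrimes` (`ε ≤ 772/775`,
`p ≠ 61`): the residual family I is empty for every `p`. -/
theorem no_levelOne_witness_of_dicksonList_all (hp47 : 47 ≤ p) {n : ZMod p}
    (hn : ∀ x : ZMod p, x * x ≠ n) (hD : DicksonList p n)
    {ε : ℝ} (hε : 0 < ε) (hε1 : ε ≤ 1)
    {H₁ H₂ H₃ : Subgroup (GLm p 2)} (htpp : SubgroupTPP H₁ H₂ H₃)
    (hdesign : ∃ c : Mat p 2 → ℂ, (∀ M, 1 < M.rank → c M = 0) ∧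
      (∑ M, c M * ZMod.stdAddChar (Matrix.trace (M * ((1 : GLm p 2) : Mat p 2)))) = 1 ∧
      ∀ a ∈ H₁, ∀ b ∈ H₂, ∀ g ∈ H₃, a * b * g ≠ 1 →
        (∑ M, c M *
          ZMod.stdAddChar (Matrix.trace (M * ((a * b * g : GLm p 2) : Mat p 2)))) = 0) :
    ¬ budget p 2 1 (2 + ε) <
      ((Nat.card H₁ * Nat.card H₂ * Nat.card H₃ : ℕ) : ℝ) ^ ((2 + ε) / 3) := by
  intro hwit
  obtain ⟨hp61, -⟩ :=
    witness_status_of_dicksonList_of_fortyseven_le hp47 hn hD hε hε1 htpp hdesign hwit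
  obtain ⟨h₁, h₂, h₃⟩ := witness_conj_singerNormal_of_dicksonList hp61 hn hD hε hε1 htpp hdesign hwit
  exact no_levelOne_witness_of_conj_singerNormal (by omega) hn hε hε1 htpp hdesign h₁ h₂ h₃ hwit

/-- The same with the non-square supplied (`p` odd has one): the ONLY hypothesis beyond the data of
the triple is Dickson's list (for every non-square parameter). -/
theorem no_levelOne_witness_of_dicksonList_all' (hp47 : 47 ≤ p)
    (hD : ∀ n : ZMod p, (∀ x : ZMod p, x * x ≠ n) → DicksonList p n)
    {ε : ℝ} (hε : 0 < ε) (hε1 : ε ≤ 1)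
    {H₁ H₂ H₃ : Subgroup (GLm p 2)} (htpp : SubgroupTPP H₁ H₂ H₃)
    (hdesign : ∃ c : Mat p 2 → ℂ, (∀ M, 1 < M.rank → c M = 0) ∧
      (∑ M, c M * ZMod.stdAddChar (Matrix.trace (M * ((1 : GLm p 2) : Mat p 2)))) = 1 ∧
      ∀ a ∈ H₁, ∀ b ∈ H₂, ∀ g ∈ H₃, a * b * g ≠ 1 →
        (∑ M, c M *
          ZMod.stdAddChar (Matrix.trace (M * ((a * b * g : GLm p 2) : Mat p 2)))) = 0) :
    ¬ budget p 2 1 (2 + ε) <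
      ((Nat.card H₁ * Nat.card H₂ * Nat.card H₃ : ℕ) : ℝ) ^ ((2 + ε) / 3) := by
  have hp2 : p ≠ 2 := by omega
  obtain ⟨n, hn⟩ := FiniteField.exists_nonsquare (F := ZMod p) (by
    rw [ZMod.ringChar_zmod_n]; exact hp2)
  have hn' : ∀ x : ZMod p, x * x ≠ n := by
    intro x hx
    exact hn ⟨x, hx.symm⟩
  exact no_levelOne_witness_of_dicksonList_all hp47 hn' (hD n hn') hε hε1 htpp hdesign

end CellTwoOneClosed

end Summit.MatrixMultiplication.MatrixMultiplication.Theorems.SubgroupIdentityDesigns.Negative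

end
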